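import Literature.NumberTheory.Rogawski1990.CartanObstructionGlobal
import HarnessLib

/-!
# The obstruction of a regular stable class of `U(H)` is a CLASS FUNCTION: `cartanObsFun p = cartanObsFun q` for `U(H)(𝐀)`-conjugate matching adèles
# (Rogawski 1990, §3.3 (3.3.1) p. 22; Kottwitz 1986 §9)

Topic `NumberTheory/Rogawski1990`; namespace `Literature.NumberTheory.Rogawski1990`; **THEOREMS ONLY** (no definition, no named fact, no instance,
no notation, no `sorry`).  Cell `pub/hodgecm-mathlib`, ENGINE T1 (crux H413 = `stmt-HodgeConjecture-24833`), row G6, sub-row R6d (E) of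
`BLUEPRINT-R6dR7-CartanObsHasse.F0P5a-p03g4` (0a35b92f, «`cartanObs_eq_of_isConjAdele`»): the obstruction ★ `MatchingAdeleG₂.cartanObsFun`
(`CartanObstruction`) depends only on the `U(H)(𝔸)`-conjugacy class of the matching adèle — what every consumer that reads `obs` through a CLASS weight
(★ `PreStabilisationCountSigns`'s `hW : W x [q] = (−1)^{(obs q)_{s x}}`, the κ-orbital sums) needs.  HC_CM is proved only modulo the printed citations
until rung 0 closes.

THE PRINT.  [Rogawski1990, §3.3 p. 22]: «`obs(γ′)` depends only on the `G(𝐀)`-conjugacy class of `γ′`» — two adelic conjugators of conjugate adèles give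
Cartan classes differing by a norm `t⋆ · t`, `t ∈ T(𝐀)` [(3.3.1)], and norms die in `H¹`; [Kottwitz1986, §9].

WHAT IS PROVED (CM letters of ★ `CartanObstruction`; `X_p := adelicCartanRepr p`, `τ := cartanInvolutionCM`, `Ψ := adelicCartanGlue`).
* `isPrincipalNormAt_mul_mul_map_iff` — «principal × norm at `𝔪`» is invariant under `X ↦ X · T · (1 ⊗ τ)T` for an adelic UNIT `T` (pure algebra).
* `MatchingAdeleG₂.exists_adelicCartanRepr_eq_mul_mul_map_of_isConjAdele` — for `p ∼ q` in `U(H)(𝔸)`: `X_q = X_p · T · (1 ⊗ τ)T` for a unit `T`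
  (★ `exists_commute_adelicCartan_eq_of_isConjAdele` pulled back through `Ψ`, ★ (G2), the commutant of the regular `γ₀ ⊗ 1` being commutative).
* **`MatchingAdeleG₂.cartanObsFun_eq_of_isConjAdele`** — `p.IsConjAdele q → p.cartanObsFun = q.cartanObsFun`.

## References
* [Rogawski1990] J. D. Rogawski, *Automorphic Representations of Unitary Groups in Three Variables*, Ann. of Math. Stud. 123 (1990), §3.3 (3.3.1) p. 22;
  §3.5 Prop. 3.5.2 p. 29.
* [Kottwitz1986] R. E. Kottwitz, *Stable trace formula: elliptic singular terms*, Math. Ann. 275 (1986), §9.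
-/

set_option autoImplicit false

noncomputable section

open NumberField IsDedekindDomain
open scoped TensorProduct Matrix MatrixGroups

namespace Literature.NumberTheory.Rogawski1990

open Literature.NumberTheory.Automorphic Literature.NumberTheory.GaloisRepresentations Literature.LinearAlgebra.Matrix
open Literature.AlgebraicGeometry.ShimuraVarieties (unitaryGroup)

section ClassFunction

variable {L : Type} [Field L] [NumberField L] [IsCMField L] {H : Matrix (Fin 3) (Fin 3) L} {γ₀ : (UnitaryGroup.cmDatum L 3 H).Rational}

/-- **«Principal × norm at `𝔪`» is invariant under multiplication by an adelic norm `T · (1 ⊗ τ)T`** (`T` a unit): if `(1 ⊗ π) X = (1 ⊗ π)((1 ⊗ k) u (1 ⊗ τ)u)`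
then `(1 ⊗ π)(X T (1 ⊗ τ)T) = (1 ⊗ π)((1 ⊗ k) (uT) (1 ⊗ τ)(uT))`, and back with `T⁻¹`. [cite: Rogawski1990, §3.3 (3.3.1) p. 22] -/
theorem isPrincipalNormAt_mul_mul_map_iff (hH : (H.map (cmConjRingHom L))ᵀ = H) (hHd : IsUnit H.det)
    (hreg : IsRegularElt ((γ₀ : unitaryGroup (cmConjRingHom L) H).val : GL (Fin 3) L)) (X : adelicCartanAlgebra γ₀) (T : (adelicCartanAlgebra γ₀)ˣ)
    (𝔪 : MaximalSpectrum ↥(cartanSubalgebra γ₀)) :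
    IsPrincipalNormAt hH hHd hreg (X * (T : adelicCartanAlgebra γ₀) * Algebra.TensorProduct.map (AlgHom.id (AdeleRing (𝓞 ↥(maximalRealSubfield L)) ↥(maximalRealSubfield L)) (AdeleRing (𝓞 ↥(maximalRealSubfield L)) ↥(maximalRealSubfield L))) (cartanInvolutionCM hH hHd hreg : ↥(cartanSubalgebra γ₀) →ₐ[↥(maximalRealSubfield L)] ↥(cartanSubalgebra γ₀)) (T : adelicCartanAlgebra γ₀)) 𝔪 ↔ IsPrincipalNormAt hH hHd hreg X 𝔪 := by
  -- one direction for all `X`, `T`; the other by `T⁻¹`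
  have key : ∀ (Y : adelicCartanAlgebra γ₀) (S : (adelicCartanAlgebra γ₀)ˣ), IsPrincipalNormAt hH hHd hreg Y 𝔪 →
      IsPrincipalNormAt hH hHd hreg (Y * (S : adelicCartanAlgebra γ₀) * Algebra.TensorProduct.map (AlgHom.id (AdeleRing (𝓞 ↥(maximalRealSubfield L)) ↥(maximalRealSubfield L)) (AdeleRing (𝓞 ↥(maximalRealSubfield L)) ↥(maximalRealSubfield L))) (cartanInvolutionCM hH hHd hreg : ↥(cartanSubalgebra γ₀) →ₐ[↥(maximalRealSubfield L)] ↥(cartanSubalgebra γ₀)) (S : adelicCartanAlgebra γ₀)) 𝔪 := by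
    rintro Y S ⟨k, u, u', hk, hkτ, huu', hY⟩
    refine ⟨k, u * (S : adelicCartanAlgebra γ₀), ((S⁻¹ : (adelicCartanAlgebra γ₀)ˣ) : adelicCartanAlgebra γ₀) * u', hk, hkτ, ?_, ?_⟩
    · rw [show u * (S : adelicCartanAlgebra γ₀) * (((S⁻¹ : (adelicCartanAlgebra γ₀)ˣ) : adelicCartanAlgebra γ₀) * u') = u * u' by
        rw [mul_assoc, ← mul_assoc (S : adelicCartanAlgebra γ₀), Units.mul_inv, one_mul], huu']
    · rw [map_mul, map_mul, hY, ← map_mul, ← map_mul, map_mul (Algebra.TensorProduct.map (AlgHom.id (AdeleRing (𝓞 ↥(maximalRealSubfield L)) ↥(maximalRealSubfield L)) (AdeleRing (𝓞 ↥(maximalRealSubfield L)) ↥(maximalRealSubfield L))) (cartanInvolutionCM hH hHd hreg : ↥(cartanSubalgebra γ₀) →ₐ[↥(maximalRealSubfield L)] ↥(cartanSubalgebra γ₀))) u]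
      congr 1
      ring
  constructor
  · intro h
    have h' := key _ T⁻¹ h
    have hXT : X * (T : adelicCartanAlgebra γ₀) * Algebra.TensorProduct.map (AlgHom.id (AdeleRing (𝓞 ↥(maximalRealSubfield L)) ↥(maximalRealSubfield L)) (AdeleRing (𝓞 ↥(maximalRealSubfield L)) ↥(maximalRealSubfield L))) (cartanInvolutionCM hH hHd hreg : ↥(cartanSubalgebra γ₀) →ₐ[↥(maximalRealSubfield L)] ↥(cartanSubalgebra γ₀)) (T : adelicCartanAlgebra γ₀) * ((T⁻¹ : (adelicCartanAlgebra γ₀)ˣ) : adelicCartanAlgebra γ₀) *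
        Algebra.TensorProduct.map (AlgHom.id (AdeleRing (𝓞 ↥(maximalRealSubfield L)) ↥(maximalRealSubfield L)) (AdeleRing (𝓞 ↥(maximalRealSubfield L)) ↥(maximalRealSubfield L))) (cartanInvolutionCM hH hHd hreg : ↥(cartanSubalgebra γ₀) →ₐ[↥(maximalRealSubfield L)] ↥(cartanSubalgebra γ₀)) ((T⁻¹ : (adelicCartanAlgebra γ₀)ˣ) : adelicCartanAlgebra γ₀) = X := by
      calc _ = X * ((T : adelicCartanAlgebra γ₀) * ((T⁻¹ : (adelicCartanAlgebra γ₀)ˣ) : adelicCartanAlgebra γ₀)) *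
            Algebra.TensorProduct.map (AlgHom.id (AdeleRing (𝓞 ↥(maximalRealSubfield L)) ↥(maximalRealSubfield L)) (AdeleRing (𝓞 ↥(maximalRealSubfield L)) ↥(maximalRealSubfield L))) (cartanInvolutionCM hH hHd hreg : ↥(cartanSubalgebra γ₀) →ₐ[↥(maximalRealSubfield L)] ↥(cartanSubalgebra γ₀)) ((T : adelicCartanAlgebra γ₀) * ((T⁻¹ : (adelicCartanAlgebra γ₀)ˣ) : adelicCartanAlgebra γ₀)) := by rw [map_mul]; ring
        _ = X := by rw [Units.mul_inv, map_one, mul_one, mul_one]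
    rwa [hXT] at h'
  · exact key X T

/-- **Conjugate matching adèles have norm-equivalent Cartan representatives**: for `p ∼ q` under `U(H)(𝔸)`, `X_q = X_p · T · (1 ⊗ τ)T` for a unit `T`
of the adelic Cartan algebra — ★ `exists_commute_adelicCartan_eq_of_isConjAdele` (`x_{g(q)} = t⋆ x_{g(p)} t`, `t` commuting with `γ₀ ⊗ 1`) pulled back
through `Ψ` ((G2), injectivity, commutativity of the commutant). [cite: Rogawski1990, §3.3 (3.3.1) p. 22] [cite: Kottwitz1986, §9] -/
theorem MatchingAdeleG₂.exists_adelicCartanRepr_eq_mul_mul_map_of_isConjAdele (hH : (H.map (cmConjRingHom L))ᵀ = H) (hHd : IsUnit H.det)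
    (hreg : IsRegularElt ((γ₀ : unitaryGroup (cmConjRingHom L) H).val : GL (Fin 3) L)) {p q : MatchingAdeleG₂ L H H γ₀} (hpq : p.IsConjAdele q) :
    ∃ T : (adelicCartanAlgebra γ₀)ˣ,
      ((q.adelicCartanRepr hH hHd hreg : (adelicCartanAlgebra γ₀)ˣ) : adelicCartanAlgebra γ₀) =
        ((p.adelicCartanRepr hH hHd hreg : (adelicCartanAlgebra γ₀)ˣ) : adelicCartanAlgebra γ₀) * (T : adelicCartanAlgebra γ₀) *
          Algebra.TensorProduct.map (AlgHom.id (AdeleRing (𝓞 ↥(maximalRealSubfield L)) ↥(maximalRealSubfield L)) (AdeleRing (𝓞 ↥(maximalRealSubfield L)) ↥(maximalRealSubfield L))) (cartanInvolutionCM hH hHd hreg : ↥(cartanSubalgebra γ₀) →ₐ[↥(maximalRealSubfield L)] ↥(cartanSubalgebra γ₀)) (T : adelicCartanAlgebra γ₀) := by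
  classical
  have hregM : (((γ₀ : unitaryGroup (cmConjRingHom L) H).val : GL (Fin 3) L) : Matrix (Fin 3) (Fin 3) L).charpoly.Separable := hreg
  have hγA : ((((UnitaryGroup.cmDatum L 3 H).toAdelic γ₀).val : GL (Fin 3) (AdeleRing (𝓞 L) L)) : Matrix (Fin 3) (Fin 3) (AdeleRing (𝓞 L) L)) = (((γ₀ : unitaryGroup (cmConjRingHom L) H).val : GL (Fin 3) L) : Matrix (Fin 3) (Fin 3) L).map (algebraMap L (AdeleRing (𝓞 L) L)) := rfl
  have hHAdet : IsUnit (H.map (algebraMap L (AdeleRing (𝓞 L) L))).det := isUnit_det_adelicForm hHd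
  have hγAU : ((((((UnitaryGroup.cmDatum L 3 H).toAdelic γ₀).val : GL (Fin 3) (AdeleRing (𝓞 L) L)) : Matrix (Fin 3) (Fin 3) (AdeleRing (𝓞 L) L))).map (adeleConj L))ᵀ * H.map (algebraMap L (AdeleRing (𝓞 L) L)) * ((((UnitaryGroup.cmDatum L 3 H).toAdelic γ₀).val : GL (Fin 3) (AdeleRing (𝓞 L) L)) : Matrix (Fin 3) (Fin 3) (AdeleRing (𝓞 L) L)) = H.map (algebraMap L (AdeleRing (𝓞 L) L)) := toAdelic_val_mem_unitaryGroup γ₀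
  have hγB : (((γ₀ : unitaryGroup (cmConjRingHom L) H).val : GL (Fin 3) L) : Matrix (Fin 3) (Fin 3) L) ∈ cartanSubalgebra γ₀ := Algebra.self_mem_adjoin_singleton L _
  have hinj : Function.Injective (adelicCartanGlue (F := ↥(maximalRealSubfield L)) (cartanSubalgebra γ₀)) := adelicCartanGlue_injective _
  obtain ⟨t, ht, hx⟩ := exists_commute_adelicCartan_eq_of_isConjAdele hHd hpq (p.adelicConjugator_conj hreg) (q.adelicConjugator_conj hreg)
  -- pull `t` and `t⁻¹` back through `Ψ`
  have htγ : Commute ((((γ₀ : unitaryGroup (cmConjRingHom L) H).val : GL (Fin 3) L) : Matrix (Fin 3) (Fin 3) L).map (algebraMap L (AdeleRing (𝓞 L) L))) (t : Matrix (Fin 3) (Fin 3) (AdeleRing (𝓞 L) L)) := by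
    have := congrArg (fun u : GL (Fin 3) (AdeleRing (𝓞 L) L) => (u : Matrix (Fin 3) (Fin 3) (AdeleRing (𝓞 L) L))) ht
    simp only [Units.val_mul] at this
    rw [← hγA]; exact this.symm
  have ht'γ : Commute ((((γ₀ : unitaryGroup (cmConjRingHom L) H).val : GL (Fin 3) L) : Matrix (Fin 3) (Fin 3) L).map (algebraMap L (AdeleRing (𝓞 L) L))) ((t⁻¹ : GL (Fin 3) (AdeleRing (𝓞 L) L)) : Matrix (Fin 3) (Fin 3) (AdeleRing (𝓞 L) L)) := by
    have hc : Commute t (((UnitaryGroup.cmDatum L 3 H).toAdelic γ₀).val : GL (Fin 3) (AdeleRing (𝓞 L) L)) := ht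
    have := congrArg (fun u : GL (Fin 3) (AdeleRing (𝓞 L) L) => (u : Matrix (Fin 3) (Fin 3) (AdeleRing (𝓞 L) L))) hc.inv_left.eq
    simp only [Units.val_mul] at this
    rw [← hγA]; exact this.symm
  obtain ⟨T₁, hT₁⟩ := mem_range_adelicCartanGlue_of_commute (F := ↥(maximalRealSubfield L)) (cartanSubalgebra γ₀) hγB hregM htγ
  obtain ⟨T₁', hT₁'⟩ := mem_range_adelicCartanGlue_of_commute (F := ↥(maximalRealSubfield L)) (cartanSubalgebra γ₀) hγB hregM ht'γ
  have hTT : T₁ * T₁' = 1 := hinj (by rw [map_mul, hT₁, hT₁', ← Units.val_mul, mul_inv_cancel, Units.val_one, map_one])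
  have hTT' : T₁' * T₁ = 1 := by rw [mul_comm]; exact hTT
  refine ⟨⟨T₁, T₁', hTT, hTT'⟩, hinj ?_⟩
  have htsγ : Commute ((((γ₀ : unitaryGroup (cmConjRingHom L) H).val : GL (Fin 3) L) : Matrix (Fin 3) (Fin 3) L).map (algebraMap L (AdeleRing (𝓞 L) L))) (hermStar (adeleConj L) (H.map (algebraMap L (AdeleRing (𝓞 L) L))) (t : Matrix (Fin 3) (Fin 3) (AdeleRing (𝓞 L) L))) := by
    rw [hermStar_def, ← hγA]; exact commute_hermAdjoint_of_commute (adeleConj L) hHAdet hγAU (by rw [hγA]; exact htγ)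
  rw [map_mul, map_mul, q.adelicCartanGlue_adelicCartanRepr hH hHd hreg, hx, p.adelicCartanGlue_adelicCartanRepr hH hHd hreg,
    adelicCartanGlue_map_cartanInvolutionCM hH hHd hreg]
  change _ = _ * (adelicCartanGlue (F := ↥(maximalRealSubfield L)) (cartanSubalgebra γ₀)) T₁ * hermStar (adeleConj L) (H.map (algebraMap L (AdeleRing (𝓞 L) L))) (adelicCartanGlue (F := ↥(maximalRealSubfield L)) (cartanSubalgebra γ₀) T₁)
  rw [hT₁]
  -- `t⋆ x t = x t t⋆` in the commutative commutant of `γ₀ ⊗ 1`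
  have hxγ : Commute ((((γ₀ : unitaryGroup (cmConjRingHom L) H).val : GL (Fin 3) L) : Matrix (Fin 3) (Fin 3) L).map (algebraMap L (AdeleRing (𝓞 L) L)))
      ((H.map (algebraMap L (AdeleRing (𝓞 L) L)))⁻¹ * twistGram (adeleConj L) (H.map (algebraMap L (AdeleRing (𝓞 L) L))) ((p.adelicConjugator hreg : GL (Fin 3) (AdeleRing (𝓞 L) L)) : Matrix (Fin 3) (Fin 3) (AdeleRing (𝓞 L) L))) := by
    rw [← hγA]; exact (commute_adelicCartan hHd p (p.adelicConjugator_conj hreg)).symm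
  rw [(commute_of_commute_map_of_charpoly_separable _ hregM htsγ hxγ).eq, Matrix.mul_assoc,
    (commute_of_commute_map_of_charpoly_separable _ hregM htsγ htγ).eq, ← Matrix.mul_assoc]

/-- **THE OBSTRUCTION IS A CLASS FUNCTION on `𝒞′_𝐀(γ₀)`**: `U(H)(𝔸)`-conjugate matching adèles have the same obstruction vector.
[cite: Rogawski1990, §3.3 (3.3.1) p. 22] [cite: Kottwitz1986, §9] -/
theorem MatchingAdeleG₂.cartanObsFun_eq_of_isConjAdele (hH : (H.map (cmConjRingHom L))ᵀ = H) (hHd : IsUnit H.det)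
    (hreg : IsRegularElt ((γ₀ : unitaryGroup (cmConjRingHom L) H).val : GL (Fin 3) L)) {p q : MatchingAdeleG₂ L H H γ₀} (hpq : p.IsConjAdele q) :
    p.cartanObsFun hH hHd hreg = q.cartanObsFun hH hHd hreg := by
  obtain ⟨T, hT⟩ := MatchingAdeleG₂.exists_adelicCartanRepr_eq_mul_mul_map_of_isConjAdele hH hHd hreg hpq
  funext 𝔪
  rcases p.cartanObsFun_eq_zero_or_eq_one hH hHd hreg 𝔪 with h0 | h1
  · rw [h0, eq_comm, q.cartanObsFun_eq_zero_iff hH hHd hreg 𝔪, hT, isPrincipalNormAt_mul_mul_map_iff]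
    exact (p.cartanObsFun_eq_zero_iff hH hHd hreg 𝔪).1 h0
  · rw [h1, eq_comm, q.cartanObsFun_eq_one_iff hH hHd hreg 𝔪, hT, isPrincipalNormAt_mul_mul_map_iff]
    exact (p.cartanObsFun_eq_one_iff hH hHd hreg 𝔪).1 h1

end ClassFunction

end Literature.NumberTheory.Rogawski1990

end
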